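import Summits.HodgeConjecture.HodgeConjecture.Theorems.MarkmanPartnerTransportPartnerExistenceLatticeHodgeIndex

/-!
# Route MarkmanPartnerTransport · support `PartnerExistence` (stmt-HodgeConjecture-19655) —
# complexification of a rational map `ℚ²³ → ℚ²²` and transport of the period

For the partner construction one transports the period `z ∈ T_ℚ ⊗ ℂ ⊂ ℂ²³` of the marked fourfold along
a `ℚ`-linear map `F : ℚ²³ → ℚ²²` which is a `q`-ISOMETRY ON `T_ℚ` (the Hasse–Minkowski embedding of
`…PartnerExistenceLatticeSignature`, extended by anything on `N_ℚ`).  This file provides the matrix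
complexification `F_ℂ = Matrix.toLin' ((LinearMap.toMatrix' F).map (ℚ → ℂ))` and realification `F_ℝ`,
their compatibilities with `ℚ ⊂ ℝ ⊂ ℂ` and complex conjugation, and the transported form identities
`(F_ℂ y . F_ℂ y') = q(y, y')` on `T_ℚ ⊗ ℂ`, `(F_ℝ w . F_ℝ w') = q(w, w')` on `T_ℚ ⊗ ℝ` (bilinear extension
from the rational generators).  Consequently the transported period `x = F_ℂ z` satisfies the period
conditions `(x.x) = 0`, `(x̄.x) > 0` of `Surfaces.Huybrechts_K3_periodSurjective_projective`.

* `cx_ratCast`, `cx_star`, `cx_realCast`, `rl_ratCast`, `re_cx`, `im_cx` — casting lemmas;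
* `re_im_mem_span_realCast` — real and imaginary parts of `R ⊗ ℂ` lie in `R ⊗ ℝ`;
* `k3Form_cx_cx`, `k3FormR_rl_rl` — transported form identities;
* `period_transport` — `(x.x) = 0` and `0 < Re (x̄.x)` for `x = F_ℂ z`.

No definition, no sorry, no named fact. Prover seat hodge-nonav-19652-p1 (gen 5), `--supports stmt-HodgeConjecture-19655`.

References: D. Huybrechts, *Lectures on K3 Surfaces*, Ch. 6 §1.1, Prop. 1.2 and Ch. 3 §2; D. Morrison,
Invent. Math. 75 (1984) §1–2.
-/

noncomputable section

set_option linter.dupNamespace false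

open scoped Matrix
open Module CategoryTheory
open Literature.AlgebraicTopology.SingularHomology Literature.Geometry.Kaehler
open Literature.AlgebraicGeometry Literature.AlgebraicGeometry.Motives Literature.AlgebraicGeometry.HodgeTheory
open Literature.AlgebraicGeometry.Hyperkaehler Literature.AlgebraicGeometry.Surfaces
open Summit.HodgeConjecture.HodgeConjecture.Theorems.NikulinTwinTransport
open Summit.HodgeConjecture.HodgeConjecture.Theorems.AnchorExistenceCMFloor
open Summit.HodgeConjecture.HodgeConjecture.Theorems.MarkmanPartnerTransport.BBFPositivity
open Summit.HodgeConjecture.HodgeConjecture.Theorems.MarkmanPartnerTransport.PartnerExistenceSignature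

namespace Summit.HodgeConjecture.HodgeConjecture.Theorems.MarkmanPartnerTransport.PartnerLattice

variable {X : SchemeOver ℂ}

/-- `MarkedK3Sq[X, φ, P, z]`: VERBATIM the `let MarkedK3Sq := …` binder of the route declarations of
MarkmanPartnerTransport (clauses (m1)–(m6)). Local notation only. -/
local notation3 (prettyPrint := false) "MarkedK3Sq[" X ", " φ ", " P ", " z "]" =>
  (((IsIntegralClass P ∧ ∀ Q : complexBetti X (2 * 4), IsIntegralClass Q → ∃ n : ℤ, Q = n • P) ∧
    (∀ c : complexBetti X 2, IsIntegralClass c ↔ ∃ v : K3HilbertIndex → ℤ, φ c = fun i => (v i : ℂ)) ∧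
    (∀ a : complexBetti X 2, cupPowTwo a 4 = ((3 : ℂ) * (k3HilbertForm 2 (φ a) (φ a)) ^ 2) • P) ∧
    (IsOfHodgeType 4 X 2 2 0 (LinearEquiv.symm φ z) ∧
      ∀ τ : complexBetti X 2, IsOfHodgeType 4 X 2 2 0 τ → ∃ t : ℂ, τ = t • LinearEquiv.symm φ z) ∧
    (∀ c : complexBetti X 2, IsOfHodgeType 4 X 2 1 1 c ↔
      (k3HilbertForm 2 (φ c) z = 0 ∧ k3HilbertForm 2 (φ c) (star z) = 0)) ∧
    (k3HilbertForm 2 z z = 0 ∧ 0 < (k3HilbertForm 2 (star z) z).re)))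

/-- `qQ` = the rational Beauville–Bogomolov form of `K3^{[2]}`-type on `ℚ²³`. Local notation only. -/
local notation3 (prettyPrint := false) "qQ" => Matrix.toBilin' (Matrix.map (k3HilbertGram 2) (Int.cast : ℤ → ℚ))

/-- `qR` = the real Beauville–Bogomolov form of `K3^{[2]}`-type on `ℝ²³`. Local notation only. -/
local notation3 (prettyPrint := false) "qR" => Matrix.toBilin' (Matrix.map (k3HilbertGram 2) (Int.cast : ℤ → ℝ))

/-- `cx[F]` = the complexification `ℂ²³ → ℂ²²` of a `ℚ`-linear `F : ℚ²³ → ℚ²²` (its rational matrix read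
over `ℂ`). Local notation only. -/
local notation3 (prettyPrint := false) "cx[" F "]" =>
  Matrix.toLin' (Matrix.map (LinearMap.toMatrix' (R := ℚ) F) (Rat.cast : ℚ → ℂ))

/-- `rl[F]` = the realification `ℝ²³ → ℝ²²` of a `ℚ`-linear `F : ℚ²³ → ℚ²²`. Local notation only. -/
local notation3 (prettyPrint := false) "rl[" F "]" =>
  Matrix.toLin' (Matrix.map (LinearMap.toMatrix' (R := ℚ) F) (Rat.cast : ℚ → ℝ))

section Cast

variable (F : (K3HilbertIndex → ℚ) →ₗ[ℚ] (K3Index → ℚ))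

/-! ### Casting lemmas -/

/-- `F_ℂ` extends `F`: `F_ℂ(v) = F(v)` on rational vectors. [folklore] -/
theorem cx_ratCast (v : K3HilbertIndex → ℚ) :
    cx[F] (fun i => (v i : ℂ)) = fun i => ((F v) i : ℂ) := by
  rw [Matrix.toLin'_apply]
  funext i
  have h := (RingHom.map_mulVec (Rat.castHom ℂ) (LinearMap.toMatrix' F) v i).symm
  rw [LinearMap.toMatrix'_mulVec] at h
  simp only [Rat.coe_castHom, Function.comp_def] at h
  exact h

/-- `F_ℝ` extends `F`: `F_ℝ(v) = F(v)` on rational vectors. [folklore] -/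
theorem rl_ratCast (v : K3HilbertIndex → ℚ) :
    rl[F] (fun i => (v i : ℝ)) = fun i => ((F v) i : ℝ) := by
  rw [Matrix.toLin'_apply]
  funext i
  have h := (RingHom.map_mulVec (Rat.castHom ℝ) (LinearMap.toMatrix' F) v i).symm
  rw [LinearMap.toMatrix'_mulVec] at h
  simp only [Rat.coe_castHom, Function.comp_def] at h
  exact h

/-- `F_ℂ` commutes with complex conjugation (its matrix is rational). [folklore] -/
theorem cx_star (w : K3HilbertIndex → ℂ) : cx[F] (star w) = star (cx[F] w) := by
  rw [Matrix.toLin'_apply, Matrix.toLin'_apply]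
  funext i
  simp only [Matrix.mulVec, dotProduct, Matrix.map_apply, Pi.star_apply, star_sum, star_mul',
    Complex.star_def, map_ratCast]

/-- `F_ℂ` extends `F_ℝ`: `F_ℂ(w) = F_ℝ(w)` on real vectors. [folklore] -/
theorem cx_realCast (w : K3HilbertIndex → ℝ) :
    cx[F] (fun i => ((w i : ℝ) : ℂ)) = fun i => ((rl[F] w i : ℝ) : ℂ) := by
  rw [Matrix.toLin'_apply, Matrix.toLin'_apply]
  funext i
  simp only [Matrix.mulVec, dotProduct, Matrix.map_apply, Complex.ofReal_sum, Complex.ofReal_mul,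
    Complex.ofReal_ratCast]

/-- `Re ∘ F_ℂ = F_ℝ ∘ Re`. [folklore] -/
theorem re_cx (y : K3HilbertIndex → ℂ) : (fun i => (cx[F] y i).re) = rl[F] (fun i => (y i).re) := by
  rw [Matrix.toLin'_apply, Matrix.toLin'_apply]
  funext i
  simp only [Matrix.mulVec, dotProduct, Matrix.map_apply, Complex.re_sum, Complex.mul_re,
    Complex.ratCast_re, Complex.ratCast_im, zero_mul, sub_zero]

/-- `Im ∘ F_ℂ = F_ℝ ∘ Im`. [folklore] -/
theorem im_cx (y : K3HilbertIndex → ℂ) : (fun i => (cx[F] y i).im) = rl[F] (fun i => (y i).im) := by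
  rw [Matrix.toLin'_apply, Matrix.toLin'_apply]
  funext i
  simp only [Matrix.mulVec, dotProduct, Matrix.map_apply, Complex.im_sum, Complex.mul_im,
    Complex.ratCast_re, Complex.ratCast_im, zero_mul, add_zero]

end Cast

/-! ### Real and imaginary parts of `R ⊗ ℂ` lie in `R ⊗ ℝ` -/

/-- **Real and imaginary parts of a vector of `R ⊗ ℂ` lie in `R ⊗ ℝ`** for a `ℚ`-subspace `R ⊆ ℚ^ι`. [folklore] -/
theorem re_im_mem_span_realCast {ι : Type*} (R : Submodule ℚ (ι → ℚ)) {y : ι → ℂ}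
    (hy : y ∈ Submodule.span ℂ ((fun a : ι → ℚ => fun i => (a i : ℂ)) '' (R : Set (ι → ℚ)))) :
    (fun i => (y i).re) ∈ Submodule.span ℝ ((fun a : ι → ℚ => fun i => (a i : ℝ)) '' (R : Set (ι → ℚ))) ∧
      (fun i => (y i).im) ∈ Submodule.span ℝ ((fun a : ι → ℚ => fun i => (a i : ℝ)) '' (R : Set (ι → ℚ))) := by
  induction hy using Submodule.span_induction with
  | mem x hx =>
    obtain ⟨a, ha, rfl⟩ := hx
    have h1 : (fun i => (((fun a : ι → ℚ => fun i => (a i : ℂ)) a i).re)) = fun i => (a i : ℝ) := by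
      funext i; simp
    have h2 : (fun i => (((fun a : ι → ℚ => fun i => (a i : ℂ)) a i).im)) = 0 := by
      funext i; simp
    rw [h1, h2]
    exact ⟨Submodule.subset_span ⟨a, ha, rfl⟩, Submodule.zero_mem _⟩
  | zero =>
    have h : (fun i => ((0 : ι → ℂ) i).re) = 0 := by funext i; simp
    have h' : (fun i => ((0 : ι → ℂ) i).im) = 0 := by funext i; simp
    rw [h, h']
    exact ⟨Submodule.zero_mem _, Submodule.zero_mem _⟩
  | add x y _ _ hx hy =>
    have h : (fun i => ((x + y) i).re) = (fun i => (x i).re) + fun i => (y i).re := by funext i; simp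
    have h' : (fun i => ((x + y) i).im) = (fun i => (x i).im) + fun i => (y i).im := by funext i; simp
    rw [h, h']
    exact ⟨Submodule.add_mem _ hx.1 hy.1, Submodule.add_mem _ hx.2 hy.2⟩
  | smul c x _ hx =>
    have h : (fun i => ((c • x) i).re) = c.re • (fun i => (x i).re) - c.im • fun i => (x i).im := by
      funext i
      simp only [Pi.smul_apply, Pi.sub_apply, smul_eq_mul, Complex.mul_re]
    have h' : (fun i => ((c • x) i).im) = c.re • (fun i => (x i).im) + c.im • fun i => (x i).re := by
      funext i
      simp only [Pi.smul_apply, Pi.add_apply, smul_eq_mul, Complex.mul_im]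
    rw [h, h']
    exact ⟨Submodule.sub_mem _ (Submodule.smul_mem _ _ hx.1) (Submodule.smul_mem _ _ hx.2),
      Submodule.add_mem _ (Submodule.smul_mem _ _ hx.2) (Submodule.smul_mem _ _ hx.1)⟩

/-! ### Transported form identities -/

section Forms

variable (F : (K3HilbertIndex → ℚ) →ₗ[ℚ] (K3Index → ℚ)) (R : Submodule ℚ (K3HilbertIndex → ℚ))

/-- **`(F_ℂ y . F_ℂ y') = q(y, y')` on `R ⊗ ℂ`** if `F` is a `q`-isometry on the `ℚ`-subspace `R`
(bilinear extension from the rational generators). [cite: Huybrechts2016K3, Ch. 3 §2] -/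
theorem k3Form_cx_cx (hF : ∀ t ∈ R, ∀ t' ∈ R, k3FormRat (F t) (F t') = qQ t t')
    {y y' : K3HilbertIndex → ℂ}
    (hy : y ∈ Submodule.span ℂ ((fun a : K3HilbertIndex → ℚ => fun i => (a i : ℂ)) '' (R : Set (K3HilbertIndex → ℚ))))
    (hy' : y' ∈ Submodule.span ℂ ((fun a : K3HilbertIndex → ℚ => fun i => (a i : ℂ)) '' (R : Set (K3HilbertIndex → ℚ)))) :
    k3Form (cx[F] y) (cx[F] y') = k3HilbertForm 2 y y' := by
  induction hy' using Submodule.span_induction with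
  | mem x' hx' =>
    obtain ⟨t', ht', rfl⟩ := hx'
    induction hy using Submodule.span_induction with
    | mem x hx =>
      obtain ⟨t, ht, rfl⟩ := hx
      beta_reduce
      rw [cx_ratCast, cx_ratCast, k3Form_ratCast, hF t ht t' ht', k3HilbertForm_ratCast]
    | zero =>
      rw [map_zero, k3Form_zero_left]
      simp [k3HilbertForm_apply]
    | add x y _ _ hx hy => rw [map_add, k3Form_add_left, k3HilbertForm_add_left, hx, hy]
    | smul c x _ hx => rw [map_smul, k3Form_smul_left, k3HilbertForm_smul_left, hx]
  | zero =>
    rw [map_zero, k3Form_zero_right]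
    simp [k3HilbertForm_apply]
  | add x y _ _ hx hy => rw [map_add, k3Form_add_right, k3HilbertForm_add_right, hx, hy]
  | smul c x _ hx => rw [map_smul, k3Form_smul_right, k3HilbertForm_smul_right, hx]

/-- **`(F_ℝ w . F_ℝ w') = q(w, w')` on `R ⊗ ℝ`** if `F` is a `q`-isometry on `R`. [cite: Huybrechts2016K3, Ch. 3 §2] -/
theorem k3FormR_rl_rl (hF : ∀ t ∈ R, ∀ t' ∈ R, k3FormRat (F t) (F t') = qQ t t')
    {w w' : K3HilbertIndex → ℝ}
    (hw : w ∈ Submodule.span ℝ ((fun a : K3HilbertIndex → ℚ => fun i => (a i : ℝ)) '' (R : Set (K3HilbertIndex → ℚ))))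
    (hw' : w' ∈ Submodule.span ℝ ((fun a : K3HilbertIndex → ℚ => fun i => (a i : ℝ)) '' (R : Set (K3HilbertIndex → ℚ)))) :
    k3FormR (rl[F] w) (rl[F] w') = qR w w' := by
  apply Complex.ofReal_injective
  rw [← k3Form_realCast, ← k3HilbertForm_realCast, ← cx_realCast, ← cx_realCast]
  exact k3Form_cx_cx F R hF (realCast_mem_span_ratCast R hw) (realCast_mem_span_ratCast R hw')

end Forms

/-! ### Transport of the period -/

section NS

variable {φ : complexBetti X 2 ≃ₗ[ℂ] (K3HilbertIndex → ℂ)} {P : complexBetti X (2 * 4)} {z : K3HilbertIndex → ℂ}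
  {NQ : Submodule ℚ (K3HilbertIndex → ℚ)}

/-- **The transported period satisfies the K3 period conditions**: for a `ℚ`-linear `F : ℚ²³ → ℚ²²`
isometric on `T_ℚ`, `x = F_ℂ z` has `(x.x) = q(z,z) = 0` and `Re (x̄.x) = Re q(z̄, z) > 0` ((m6); `z, z̄ ∈
T_ℚ ⊗ ℂ`). [cite: Huybrechts2016K3, Ch. 6 Prop. 1.2 and Thm. 3.1] -/
theorem period_transport (hX : IsSmoothProjective 4 X) (hM : MarkedK3Sq[X, φ, P, z])
    (hNQ : ∀ v, v ∈ NQ ↔ φ.symm (fun i => (v i : ℂ)) ∈ algebraicClasses X 1)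
    (F : (K3HilbertIndex → ℚ) →ₗ[ℚ] (K3Index → ℚ))
    (hF : ∀ t ∈ (qQ).orthogonal NQ, ∀ t' ∈ (qQ).orthogonal NQ, k3FormRat (F t) (F t') = qQ t t') :
    k3Form (cx[F] z) (cx[F] z) = 0 ∧ 0 < (k3Form (star (cx[F] z)) (cx[F] z)).re := by
  obtain ⟨-, -, -, -, -, hzz, hzpos⟩ := id hM
  have hz := period_mem_span_ratTransc hX hM hNQ
  have hzbar := star_period_mem_span_ratTransc hX hM hNQ
  refine ⟨?_, ?_⟩
  · rw [k3Form_cx_cx F _ hF hz hz]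
    exact hzz
  · rw [← cx_star, k3Form_cx_cx F _ hF hzbar hz]
    exact hzpos

/-- **Real and imaginary parts of the transported period**: `Re x = F_ℝ (Re z)`, `Im x = F_ℝ (Im z)`,
with `Re z, Im z ∈ T_ℚ ⊗ ℝ`. [folklore] -/
theorem re_im_period_mem (hX : IsSmoothProjective 4 X) (hM : MarkedK3Sq[X, φ, P, z])
    (hNQ : ∀ v, v ∈ NQ ↔ φ.symm (fun i => (v i : ℂ)) ∈ algebraicClasses X 1) :
    (fun i => (z i).re) ∈ Submodule.span ℝ ((fun a : K3HilbertIndex → ℚ => fun i => (a i : ℝ)) ''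
        ((qQ).orthogonal NQ : Set (K3HilbertIndex → ℚ))) ∧
      (fun i => (z i).im) ∈ Submodule.span ℝ ((fun a : K3HilbertIndex → ℚ => fun i => (a i : ℝ)) ''
        ((qQ).orthogonal NQ : Set (K3HilbertIndex → ℚ))) :=
  re_im_mem_span_realCast _ (period_mem_span_ratTransc hX hM hNQ)

end NS

end Summit.HodgeConjecture.HodgeConjecture.Theorems.MarkmanPartnerTransport.PartnerLattice

end
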